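import Summits.ResolutionOfSingularities.ResolutionOfSingularities.Theorems.ValuativeLuAlphaPTorsorResidualChartHelpers

/-!
# The residual chart of an adapted chart — transfer of the value clauses (C2a), (C2b), (C4)

Crux `Valuative.LuAlphaPTorsor` (stmt-ResolutionOfSingularities-0641), line
`pfaff-line-log-final-forms`, stub `stub_residualChart` (F⁴ᵇ of reshape v6.2–v6.3). Setting as in
`…ResidualChartHelpers` / `…ResidualChartTransfer`: a valuation ring `O` of `K`, a subring
`S ⊆ O` with parameters `x₁, …, xₙ ∈ S` of levels `lv`, a level `top`, the coarsening `W ⊇ O`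
with `z ∈ W ↔ ν z ≤ ν(x^m)` for some `m` supported on the levels `< top`, the residue valuation
ring `Ō = O/𝔪_W` of `κ(W)`, and an enumeration `e` of the parameters of level `< top` (which
are `W`-units, with non-zero residues `x̄`: `residChart_residue_param_ne_zero`). The
`ℤ`-independence of the residual values (`residChart_valIndep`) and the clauses (C2a), (C2b) (both the generator form and the lattice form
"level-archimedean") and (C4) of an adapted family of values pass from `(ν(xᵢ))ᵢ` to the
residual values `(ν̄(x̄_{e j}))ⱼ` with the same levels: each is a family of strict inequalities
between Laurent monomials in the `W`-units `x_{<top}`, and such inequalities are read off after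
reduction modulo `𝔪_W` (`residChart_prod_val_residue_lt_iff`), exponents on `Fin nS` being
extended by zero to `Fin n` (`residChart_prod_extend`). [folklore]
-/

set_option linter.dupNamespace false

noncomputable section

open IsLocalRing Literature.AlgebraicGeometry.Resolution

namespace Summit.ResolutionOfSingularities.ResolutionOfSingularities.Theorems.PfaffLine

variable {K : Type} [Field K] (O W : ValuationSubring K) (hOW : O ≤ W) {n : ℕ}
  (S : Subring K) (hSO : S ≤ O.toSubring) (x : Fin n → K) (hxS : ∀ i, x i ∈ S)
  (lv : Fin n → ℕ) (top : ℕ) {nS : ℕ} (e : Fin nS ≃ {i : Fin n // lv i < top})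

/-- **The residues of the lower parameters are non-zero.** [folklore] -/
theorem residChart_residue_param_ne_zero (hx0 : ∀ i, x i ≠ 0)
    (hW : ∀ z : K, z ∈ W ↔ ∃ m : Fin n → ℤ, (∀ j, top ≤ lv j → m j = 0) ∧
      O.valuation z ≤ ∏ j, O.valuation (x j) ^ (m j)) (j : Fin nS) :
    residue W ⟨x (e j).1, hOW (hSO (hxS (e j).1))⟩ ≠ 0 :=
  ap_residue_ne_zero_of_valuation_eq_one W _ (residChart_val_param_eq_one O W x lv top hx0 hW _ (e j).2)

/-- **Independence of the residual values** of the lower parameters. [folklore] -/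
theorem residChart_valIndep (hx0 : ∀ i, x i ≠ 0)
    (hW : ∀ z : K, z ∈ W ↔ ∃ m : Fin n → ℤ, (∀ j, top ≤ lv j → m j = 0) ∧
      O.valuation z ≤ ∏ j, O.valuation (x j) ^ (m j))
    (hind : ∀ m : Fin n → ℤ, (∏ i, O.valuation (x i) ^ (m i)) = 1 → m = 0)
    (m : Fin nS → ℤ)
    (hm : (∏ j, (residueValuationSubring O W hOW).valuation
      (residue W ⟨x (e j).1, hOW (hSO (hxS (e j).1))⟩) ^ (m j)) = 1) : m = 0 := by
  classical
  have hy1 : ∀ j : Fin nS, W.valuation (x (e j).1) = 1 := fun j =>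
    residChart_val_param_eq_one O W x lv top hx0 hW _ (e j).2
  have hle := (residChart_prod_val_residue_le_iff W (fun j => x (e j).1) hy1 O hOW m 0).mp
    (by rw [hm, residChart_prod_zpow_zero])
  have hge := (residChart_prod_val_residue_le_iff W (fun j => x (e j).1) hy1 O hOW 0 m).mp
    (by rw [hm, residChart_prod_zpow_zero])
  rw [residChart_prod_zpow_zero] at hle hge
  have heq : (∏ j, O.valuation (x (e j).1) ^ (m j)) = 1 := le_antisymm hle hge
  rw [← residChart_prod_extend e (fun i => O.valuation (x i)) m] at heq
  have h0 := hind _ heq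
  funext j
  have := congrFun h0 (e j).1
  rwa [residChart_extend_apply_enum] at this

/-- **(C2a) for the residual chart.** [folklore] -/
theorem residChart_C2a (hx0 : ∀ i, x i ≠ 0)
    (hW : ∀ z : K, z ∈ W ↔ ∃ m : Fin n → ℤ, (∀ j, top ≤ lv j → m j = 0) ∧
      O.valuation z ≤ ∏ j, O.valuation (x j) ^ (m j))
    (hC2a : ∀ i i', lv i < lv i' → ∀ m : Fin n → ℤ, (∀ j, lv i < lv j → m j = 0) →
      O.valuation (x i') < ∏ j, O.valuation (x j) ^ (m j))
    (j j' : Fin nS) (hjj' : lv (e j).1 < lv (e j').1) (m : Fin nS → ℤ)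
    (hm : ∀ l, lv (e j).1 < lv (e l).1 → m l = 0) :
    (residueValuationSubring O W hOW).valuation
        (residue W ⟨x (e j').1, hOW (hSO (hxS (e j').1))⟩) <
      ∏ l, (residueValuationSubring O W hOW).valuation
        (residue W ⟨x (e l).1, hOW (hSO (hxS (e l).1))⟩) ^ (m l) := by
  classical
  have hy1 : ∀ j : Fin nS, W.valuation (x (e j).1) = 1 := fun j =>
    residChart_val_param_eq_one O W x lv top hx0 hW _ (e j).2
  have key := hC2a (e j).1 (e j').1 hjj' (Function.extend (fun l => (e l).1) m 0)
    (residChart_extend_eq_zero e m (fun i => lv (e j).1 < lv i) hm)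
  rw [residChart_prod_extend e (fun i => O.valuation (x i)) m] at key
  exact (residChart_val_residue_lt_prod_iff W (fun l => x (e l).1) hy1 O hOW j' m).mpr key

/-- **(C2b) for the residual chart, generator form**: two lower parameters of the same level
have archimedean-comparable residual values. [folklore] -/
theorem residChart_C2b_gen (hx0 : ∀ i, x i ≠ 0)
    (hW : ∀ z : K, z ∈ W ↔ ∃ m : Fin n → ℤ, (∀ j, top ≤ lv j → m j = 0) ∧
      O.valuation z ≤ ∏ j, O.valuation (x j) ^ (m j))
    (hC2b : ∀ i i', lv i = lv i' → ∃ N : ℕ, O.valuation (x i) ^ N < O.valuation (x i'))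
    (j j' : Fin nS) (hjj' : lv (e j).1 = lv (e j').1) :
    ∃ N : ℕ, (residueValuationSubring O W hOW).valuation
        (residue W ⟨x (e j).1, hOW (hSO (hxS (e j).1))⟩) ^ N <
      (residueValuationSubring O W hOW).valuation
        (residue W ⟨x (e j').1, hOW (hSO (hxS (e j').1))⟩) := by
  obtain ⟨N, hN⟩ := hC2b (e j).1 (e j').1 hjj'
  refine ⟨N, ?_⟩
  have hyj := residChart_val_param_eq_one O W x lv top hx0 hW _ (e j).2
  have hyN : W.valuation (x (e j).1 ^ N) = 1 := by rw [map_pow, hyj, one_pow]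
  have hpow : (⟨x (e j).1, hOW (hSO (hxS (e j).1))⟩ : W) ^ N =
      ⟨x (e j).1 ^ N, residChart_mem_of_val_one W hyN⟩ := Subtype.ext (SubmonoidClass.coe_pow _ _)
  rw [← map_pow, ← map_pow, hpow, ap_resval_lt_iff O W hOW _ _ hyN, map_pow]
  exact hN

/-- **(C2b) for the residual chart** (lattice form: a level-`ℓ` monomial below all lower
monomials has a power below any other level-`ℓ` monomial). [folklore] -/
theorem residChart_C2b (hx0 : ∀ i, x i ≠ 0)
    (hW : ∀ z : K, z ∈ W ↔ ∃ m : Fin n → ℤ, (∀ j, top ≤ lv j → m j = 0) ∧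
      O.valuation z ≤ ∏ j, O.valuation (x j) ^ (m j))
    (hC2b : ∀ (ℓ : ℕ) (μ μ' : Fin n → ℤ), (∀ j, lv j ≠ ℓ → μ j = 0) → (∀ j, lv j ≠ ℓ → μ' j = 0) →
      (∀ m : Fin n → ℤ, (∀ j, ℓ ≤ lv j → m j = 0) →
        (∏ j, O.valuation (x j) ^ (μ j)) < ∏ j, O.valuation (x j) ^ (m j)) →
      ∃ N : ℕ, (∏ j, O.valuation (x j) ^ (μ j)) ^ N < ∏ j, O.valuation (x j) ^ (μ' j))
    (ℓ : ℕ) (μ μ' : Fin nS → ℤ) (hμ : ∀ j, lv (e j).1 ≠ ℓ → μ j = 0)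
    (hμ' : ∀ j, lv (e j).1 ≠ ℓ → μ' j = 0)
    (hlow : ∀ m : Fin nS → ℤ, (∀ j, ℓ ≤ lv (e j).1 → m j = 0) →
      (∏ j, (residueValuationSubring O W hOW).valuation
          (residue W ⟨x (e j).1, hOW (hSO (hxS (e j).1))⟩) ^ (μ j)) <
        ∏ j, (residueValuationSubring O W hOW).valuation
          (residue W ⟨x (e j).1, hOW (hSO (hxS (e j).1))⟩) ^ (m j)) :
    ∃ N : ℕ, (∏ j, (residueValuationSubring O W hOW).valuation
          (residue W ⟨x (e j).1, hOW (hSO (hxS (e j).1))⟩) ^ (μ j)) ^ N <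
        ∏ j, (residueValuationSubring O W hOW).valuation
          (residue W ⟨x (e j).1, hOW (hSO (hxS (e j).1))⟩) ^ (μ' j) := by
  classical
  have hy1 : ∀ j : Fin nS, W.valuation (x (e j).1) = 1 := fun j =>
    residChart_val_param_eq_one O W x lv top hx0 hW _ (e j).2
  rcases lt_or_ge ℓ top with hℓ | hℓ
  · -- transfer to (C2b) for `x`
    obtain ⟨N, hN⟩ := hC2b ℓ (Function.extend (fun l => (e l).1) μ 0)
      (Function.extend (fun l => (e l).1) μ' 0)
      (residChart_extend_eq_zero e μ (fun i => lv i ≠ ℓ) hμ)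
      (residChart_extend_eq_zero e μ' (fun i => lv i ≠ ℓ) hμ') (fun m hm => by
        have hmlow : ∀ i, ¬ lv i < top → m i = 0 := fun i hi =>
          hm i (hℓ.le.trans (not_lt.mp hi))
        rw [← residChart_extend_restrict e m hmlow,
          residChart_prod_extend e (fun i => O.valuation (x i)) μ,
          residChart_prod_extend e (fun i => O.valuation (x i))]
        exact (residChart_prod_val_residue_lt_iff W (fun l => x (e l).1) hy1 O hOW μ _).mp
          (hlow _ fun j hj => hm (e j).1 hj))
    refine ⟨N, ?_⟩
    rw [residChart_prod_extend e (fun i => O.valuation (x i)) μ,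
      residChart_prod_extend e (fun i => O.valuation (x i)) μ',
      ← residChart_prod_zpow_nsmul] at hN
    rw [← residChart_prod_zpow_nsmul]
    exact (residChart_prod_val_residue_lt_iff W (fun l => x (e l).1) hy1 O hOW _ μ').mpr hN
  · -- no lower parameter has level `ℓ ≥ top`: the hypothesis with `m = μ` is absurd
    exfalso
    have hμ0 : ∀ j, ℓ ≤ lv (e j).1 → μ j = 0 := fun j hj =>
      absurd (hℓ.trans hj) (not_le.mpr (e j).2)
    exact lt_irrefl _ (hlow μ hμ0)

/-- **(C4) for the residual chart.** [folklore] -/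
theorem residChart_C4 (hx0 : ∀ i, x i ≠ 0)
    (hW : ∀ z : K, z ∈ W ↔ ∃ m : Fin n → ℤ, (∀ j, top ≤ lv j → m j = 0) ∧
      O.valuation z ≤ ∏ j, O.valuation (x j) ^ (m j))
    (hC4 : ∀ (ℓ : ℕ) (μ : Fin n → ℤ), (∀ j, lv j ≠ ℓ → μ j = 0) → μ ≠ 0 →
      (∀ m : Fin n → ℤ, (∀ j, ℓ ≤ lv j → m j = 0) →
        (∏ j, O.valuation (x j) ^ (μ j)) < ∏ j, O.valuation (x j) ^ (m j)) ∨
      (∀ m : Fin n → ℤ, (∀ j, ℓ ≤ lv j → m j = 0) →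
        (∏ j, O.valuation (x j) ^ (m j)) < ∏ j, O.valuation (x j) ^ (μ j)))
    (ℓ : ℕ) (μ : Fin nS → ℤ) (hμ : ∀ j, lv (e j).1 ≠ ℓ → μ j = 0) (hμ0 : μ ≠ 0) :
    (∀ m : Fin nS → ℤ, (∀ j, ℓ ≤ lv (e j).1 → m j = 0) →
      (∏ j, (residueValuationSubring O W hOW).valuation
          (residue W ⟨x (e j).1, hOW (hSO (hxS (e j).1))⟩) ^ (μ j)) <
        ∏ j, (residueValuationSubring O W hOW).valuation
          (residue W ⟨x (e j).1, hOW (hSO (hxS (e j).1))⟩) ^ (m j)) ∨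
    (∀ m : Fin nS → ℤ, (∀ j, ℓ ≤ lv (e j).1 → m j = 0) →
      (∏ j, (residueValuationSubring O W hOW).valuation
          (residue W ⟨x (e j).1, hOW (hSO (hxS (e j).1))⟩) ^ (m j)) <
        ∏ j, (residueValuationSubring O W hOW).valuation
          (residue W ⟨x (e j).1, hOW (hSO (hxS (e j).1))⟩) ^ (μ j)) := by
  classical
  have hy1 : ∀ j : Fin nS, W.valuation (x (e j).1) = 1 := fun j =>
    residChart_val_param_eq_one O W x lv top hx0 hW _ (e j).2
  rcases hC4 ℓ (Function.extend (fun l => (e l).1) μ 0)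
    (residChart_extend_eq_zero e μ (fun i => lv i ≠ ℓ) hμ) (residChart_extend_ne_zero e μ hμ0)
    with h | h
  · refine Or.inl fun m hm => ?_
    have := h (Function.extend (fun l => (e l).1) m 0)
      (residChart_extend_eq_zero e m (fun i => ℓ ≤ lv i) hm)
    rw [residChart_prod_extend e (fun i => O.valuation (x i)) μ,
      residChart_prod_extend e (fun i => O.valuation (x i)) m] at this
    exact (residChart_prod_val_residue_lt_iff W (fun l => x (e l).1) hy1 O hOW μ m).mpr this
  · refine Or.inr fun m hm => ?_
    have := h (Function.extend (fun l => (e l).1) m 0)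
      (residChart_extend_eq_zero e m (fun i => ℓ ≤ lv i) hm)
    rw [residChart_prod_extend e (fun i => O.valuation (x i)) μ,
      residChart_prod_extend e (fun i => O.valuation (x i)) m] at this
    exact (residChart_prod_val_residue_lt_iff W (fun l => x (e l).1) hy1 O hOW m μ).mpr this



/-- **Level comparability of the residual parameters** (registered anchor of this helper file):
two lower parameters of the same level have archimedean-comparable residual values. [folklore] -/
theorem residChart_levelComparable : ∀ (K : Type) [Field K] (O W : ValuationSubring K) (hOW : O ≤ W) (n : ℕ) (S : Subring K) (hSO : S ≤ O.toSubring) (x : Fin n → K) (hxS : ∀ i, x i ∈ S) (lv : Fin n → ℕ) (top nS : ℕ) (e : Fin nS ≃ {i : Fin n // lv i < top}), (∀ i, x i ≠ 0) → (∀ z : K, z ∈ W ↔ ∃ m : Fin n → ℤ, (∀ j, top ≤ lv j → m j = 0) ∧ O.valuation z ≤ ∏ j, O.valuation (x j) ^ (m j)) → (∀ i i', lv i = lv i' → ∃ N : ℕ, O.valuation (x i) ^ N < O.valuation (x i')) → ∀ (j j' : Fin nS), lv (e j).1 = lv (e j').1 → ∃ N : ℕ, (Literature.AlgebraicGeometry.Resolution.residueValuationSubring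 O W hOW).valuation (IsLocalRing.residue W ⟨x (e j).1, hOW (hSO (hxS (e j).1))⟩) ^ N < (Literature.AlgebraicGeometry.Resolution.residueValuationSubring O W hOW).valuation (IsLocalRing.residue W ⟨x (e j').1, hOW (hSO (hxS (e j').1))⟩) :=
  fun _ _ O W hOW _ S hSO x hxS lv top _ e hx0 hW hC2b j j' hjj' =>
    residChart_C2b_gen O W hOW S hSO x hxS lv top e hx0 hW hC2b j j' hjj'

end Summit.ResolutionOfSingularities.ResolutionOfSingularities.Theorems.PfaffLine

end
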